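import Summits.QuantumAdvantage.QuantumAdvantage.Theses.ArithStatLadder
import Literature.NumberTheory.QuadraticFields.ThreeTorsion
import Literature.NumberTheory.QuadraticFields.ThreeTorsionProofs
import Literature.NumberTheory.QuadraticFields.ScholzReflectionArithmetic
import Literature.NumberTheory.QuadraticFields.ScholzHeckeUnitCriterion
import Literature.NumberTheory.QuadraticFields.ScholzHeckeUnitCriterionProofs
import Literature.NumberTheory.QuadraticFields.ScholzHeckeUnitCubeOfCongruence
import Literature.NumberTheory.QuadraticFields.ScholzHeckeUnitCubeOfUnramified
import Literature.NumberTheory.QuadraticFields.ScholzHeckeKummerTower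
import Literature.NumberTheory.QuadraticFields.CubeClassesOfTrivialThreeTorsion
import Literature.NumberTheory.QuadraticFields.CubicClassFieldNormal
import Literature.NumberTheory.QuadraticFields.UnitsModCubes
import Literature.NumberTheory.QuadraticFields.SquareRootGenerator
import Literature.NumberTheory.NumberFields.ClassFieldsOfIndexThree
import Literature.NumberTheory.NumberFields.AlgClosureCubeRootsOfUnity
import Literature.NumberTheory.NumberFields.ScholzKummerGenerator
import Literature.NumberTheory.NumberFields.ScholzMirrorField
import Literature.NumberTheory.NumberFields.UnramifiedCubicBaseChange
import HarnessLib

/-!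
# `3 ∣ h(−d)` and `#Cl₃(D⁺) = 1` force the mirror unit to be a cube at `3` (stub
# `stub_threeDvdImpCube` of line `mirror-unit-signature`, crux `ArithStatLadder.AvgFaceBeyondPrior`,
# stmt-QuantumAdvantage-2427)

For `−d` a negative fundamental discriminant, `d ≠ 3`, let `D⁺ = d/3` (`3 ∣ d`) resp. `3d` (`3 ∤ d`)
be the discriminant of the real mirror field `k = ℚ(√3d)` and `ε = (a + b√d₀)/2` its fundamental
unit (`IsMirrorFundUnit`).  We prove direction (ii) of the Scholz–Hecke unit criterion
(`ScholzHecke_unitCubeCriterion`): `#Cl(k)[3] = 1 ∧ 3 ∣ h(−d) ⟹ UnitCubeAtThree d`.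
Proof (Washington, *Introduction to Cyclotomic Fields*, proof of Thm 10.10, wired through the
tree's PROVED theorems): `3 ∣ h(−d) = h_K`, `K = ℚ(√−d)`, gives an index-`3` subgroup of
`Cl(𝓞_K)` and its cubic class field `E ⊆ K̄` (`exists_isCubicClassField`), unramified and
dihedral over `ℚ` (`CubicClassFieldNormal`); with `ζ = ζ₃ ∉ K`, `g ∈ Aut(K̄/ℚ)`, `g|_K ≠ 1`,
`g ζ = ζ²`, Scholz's Kummer generator (`exists_kummer_generator`) is a `θ ≠ 0` of the mirror field
`k = ℚ(δ(1+2ζ)) = ℚ(√3d)` (`δ² = −d`), a cube `λ³` in `L = E·K(ζ)` but not in `M = K(ζ)`, with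
`3 ∣ v(θ)` for all `v`.  As `Cl(k)[3] = 1` and `ε` is not the cube of a unit (minimality of `a`,
`no_rat_cube_root`), `θ = εʲz³` with `j ≠ 0` and `ε` has a cube root in `L`
(`exists_cube_root_unit`); `L/M` is unramified (`isUnramifiedAt_sup`), so Hecke's theorem 119 at
the primes above `3` yields the congruences of `UnitCubeAtThree d`
(`unitCubeAtThree_of_isUnramifiedAt`).

## References

* L. C. Washington, *Introduction to Cyclotomic Fields*, GTM 83, 2nd ed. (1997), Thm 10.10 and
  its proof. [Washington1997]
* E. Hecke, *Lectures on the Theory of Algebraic Numbers*, GTM 77 (1981), §39, Thm. 119.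
  [Hecke1981]
* A. Scholz, J. reine angew. Math. 166 (1932), 201–203. [Scholz1932]
-/

noncomputable section

-- the summit-side namespace `Summit.QuantumAdvantage.QuantumAdvantage.…` (summit = problem) is mandated by the layout
set_option linter.dupNamespace false

namespace Summit.QuantumAdvantage.QuantumAdvantage.Theorems.AvgFaceBeyondPrior.Mirror

open Literature.NumberTheory.QuadraticFields
open Literature.NumberTheory.NumberFields
open NumberField Module IsDedekindDomain WithZero
open scoped IntermediateField

/-! ### The mirror unit `ε = (a + b√d₀)/2` as a unit of `𝓞_k`, and not a cube of a unit -/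

/-- In a number field `k` containing `s` with `s² = d₀`: if `a² − d₀b² = 4n`, `n = ±1`, then
`(a + b s)/2` is (the image of) a unit of `𝓞_k` (it has trace `a` and norm `n`). [folklore] -/
theorem exists_unit_coe_eq_half {k : Type*} [Field k] [NumberField k] {s : k} {d₀ a b : ℕ} {n : ℤ}
    (hs : s ^ 2 = d₀) (hn : n = 1 ∨ n = -1) (hab : (a:ℤ) ^ 2 - (d₀ : ℤ) * (b:ℤ) ^ 2 = 4 * n) :
    ∃ u : (𝓞 k)ˣ, ((u : 𝓞 k) : k) = ((a : k) + b * s) / 2 := by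
  have habk : (a : k) ^ 2 - d₀ * (b : k) ^ 2 = 4 * n := by exact_mod_cast hab
  set ε : k := ((a : k) + b * s) / 2 with hε
  set ε' : k := ((a : k) - b * s) / 2 with hε'
  have hεε' : ε * ε' = n := by
    rw [hε, hε']
    linear_combination (1 / 4 : k) * habk - (1 / 4 : k) * (b : k) ^ 2 * hs
  have hεint : IsIntegral ℤ ε := ScholzHecke.isIntegral_of_quadratic (a := a) (n := n) (by
    push_cast
    rw [hε]
    linear_combination (1 / 4 : k) * (b : k) ^ 2 * hs - (1 / 4 : k) * habk)
  have hε'int : IsIntegral ℤ ε' := ScholzHecke.isIntegral_of_quadratic (a := a) (n := n) (by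
    push_cast
    rw [hε']
    linear_combination (1 / 4 : k) * (b : k) ^ 2 * hs - (1 / 4 : k) * habk)
  set εO : 𝓞 k := ⟨ε, hεint⟩ with hεO
  set εO' : 𝓞 k := ⟨ε', hε'int⟩ with hεO'
  have hunit : IsUnit εO := by
    refine IsUnit.of_mul_eq_one ((n : 𝓞 k) * εO') (RingOfIntegers.ext ?_)
    have h1 : (algebraMap (𝓞 k) k) εO = ε := rfl
    have h2 : (algebraMap (𝓞 k) k) εO' = ε' := rfl
    simp only [map_mul, map_one, map_intCast]
    rw [h1, h2, mul_left_comm, hεε']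
    rcases hn with rfl | rfl <;> norm_num
  exact ⟨hunit.unit, by rw [IsUnit.unit_spec]; rfl⟩

/-- **The mirror fundamental unit is not the cube of a unit.**  Let `k` be a quadratic field
containing `s ∉ ℚ` with `s² = d₀ = mirrorRadicand d` (`−d` fundamental, `d ≠ 3`), and
`(a, b)` the pair of `IsMirrorFundUnit d a b`.  A unit `η` of `𝓞_k` with `η = (a + b s)/2` is not in
`U_k³`: writing a cube root as `x + y s` (`x, y ∈ ℚ`) gives the rational identities excluded by
`ScholzHecke.no_rat_cube_root` (minimality of `a`). [folklore] -/
theorem not_mem_unitCubes_of_isMirrorFundUnit {k : Type*} [Field k] [NumberField k]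
    (h2 : finrank ℚ k = 2) {s : k} (hs : s ∉ Set.range (algebraMap ℚ k)) {d : ℕ}
    (hd : ((-(d:ℤ)) % 4 = 1 ∧ Squarefree (-(d:ℤ)) ∧ (-(d:ℤ)) ≠ 1) ∨
      (4 ∣ (-(d:ℤ)) ∧ ((-(d:ℤ)) / 4 % 4 = 2 ∨ (-(d:ℤ)) / 4 % 4 = 3) ∧ Squarefree ((-(d:ℤ)) / 4)))
    (h3 : d ≠ 3) (hs2 : s ^ 2 = (mirrorRadicand d : k)) {a b : ℕ} (hunit : IsMirrorFundUnit d a b)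
    {η : (𝓞 k)ˣ} (hη : ((η : 𝓞 k) : k) = ((a : k) + b * s) / 2) :
    η ∉ Quadratic.unitCubes k := by
  obtain ⟨hb, hab', hmin⟩ := hunit
  obtain ⟨n, hn, hab⟩ : ∃ n : ℤ, (n = 1 ∨ n = -1) ∧
      (a:ℤ) ^ 2 - (mirrorRadicand d : ℤ) * (b:ℤ) ^ 2 = 4 * n := by
    rcases hab' with h | h
    · exact ⟨1, Or.inl rfl, by rw [h]; norm_num⟩
    · exact ⟨-1, Or.inr rfl, by rw [h]; norm_num⟩
  have hsq := ScholzHecke.squarefree_mirrorRadicand hd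
  have h1 := ScholzHecke.mirrorRadicand_ne_one hd h3
  rintro ⟨u, hu⟩
  rw [powMonoidHom_apply] at hu
  -- `U³ = ε` in `k`
  have hU : (((u : (𝓞 k)ˣ) : 𝓞 k) : k) ^ 3 = ((a : k) + b * s) / 2 := by
    rw [← hη, ← hu, Units.val_pow_eq_pow_val, RingOfIntegers.coe_eq_algebraMap,
      RingOfIntegers.coe_eq_algebraMap, map_pow]
  obtain ⟨x, y, hxy⟩ := Quadratic.exists_eq_add_mul h2 hs (((u : (𝓞 k)ˣ) : 𝓞 k) : k)
  rw [hxy] at hU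
  have key : algebraMap ℚ k (x ^ 3 + 3 * (mirrorRadicand d) * x * y ^ 2) +
      algebraMap ℚ k (3 * x ^ 2 * y + (mirrorRadicand d) * y ^ 3) * s =
      algebraMap ℚ k ((a : ℚ) / 2) + algebraMap ℚ k ((b : ℚ) / 2) * s := by
    simp only [map_add, map_mul, map_pow, map_natCast, map_ofNat, map_div₀]
    linear_combination hU - (3 * algebraMap ℚ k x * (algebraMap ℚ k y) ^ 2 +
      (algebraMap ℚ k y) ^ 3 * s) * hs2
  obtain ⟨hx, hy⟩ := Quadratic.ext_add_mul hs key
  exact ScholzHecke.no_rat_cube_root hsq h1 hb hn hab hmin hx hy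

/-! ### The stub -/

set_option maxHeartbeats 800000 in
/-- **`3 ∣ h(−d)` and `#Cl(ℚ(√3d))[3] = 1` force the mirror unit to be a cube at `3`** (direction
(ii) of the Scholz–Hecke unit criterion `ScholzHecke_unitCubeCriterion`; Washington GTM 83, proof of
Thm 10.10, with Hecke's Satz 119 at the primes above `3`): for `−d` a negative fundamental
discriminant, `d ≠ 3`, `quadFieldThreeTorsion D⁺ = 1` (`D⁺ = d/3` or `3d` the discriminant of
`k = ℚ(√3d)`) and `3 ∣ h(−d)` imply `UnitCubeAtThree d`.  Proof: cubic class field `E` of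
`K = ℚ(√−d)` (Artin reciprocity) → Scholz's Kummer generator `θ ∈ k`, `θ = λ³` in `L = E·K(ζ₃)`,
`θ ∉ K(ζ₃)׳`, `(θ) = 𝔟³` → as `Cl(k)[3] = 1` and the fundamental unit `ε` of `k` is not a cube of
a unit, `ε` has a cube root in the unramified extension `L/K(ζ₃)` → Hecke: `ε ≡ ξ³ (mod 𝔓³)` for
`𝔓 ∣ 3`, i.e. the congruences of `UnitCubeAtThree d`. [cite: Washington1997, Thm 10.10 (proof)]
[cite: Hecke1981, §39 Thm. 119] -/
theorem stub_threeDvdImpCube :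
    ∀ d : ℕ, ((((-(d:ℤ)) % 4 = 1 ∧ Squarefree (-(d:ℤ)) ∧ (-(d:ℤ)) ≠ 1) ∨
        (4 ∣ (-(d:ℤ)) ∧ ((-(d:ℤ)) / 4 % 4 = 2 ∨ (-(d:ℤ)) / 4 % 4 = 3) ∧ Squarefree ((-(d:ℤ)) / 4)))) →
      d ≠ 3 → quadFieldThreeTorsion (if 3 ∣ d then ((d / 3 : ℕ) : ℤ) else 3 * (d : ℤ)) = 1 →
        3 ∣ BinaryQuadraticForm.classNumber (-(d:ℤ)) → UnitCubeAtThree d := by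
  intro d hd hd3 ht hh
  classical
  -- arithmetic data: `d > 0`, `3d = d₀ c₀²`, the fundamental unit `(a + b√d₀)/2`, `a² − d₀b² = 4n`
  have hd0 : 0 < d := ScholzHecke.pos hd
  obtain ⟨c₀, hc₀pos, hc₀⟩ := ScholzHecke.exists_three_mul_eq_mirrorRadicand_mul_sq d
  have hc₀0 : c₀ ≠ 0 := hc₀pos.ne'
  obtain ⟨a, b, hunit⟩ := ScholzHecke.exists_isMirrorFundUnit hd hd3
  obtain ⟨n, hn, hab⟩ : ∃ n : ℤ, (n = 1 ∨ n = -1) ∧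
      (a:ℤ) ^ 2 - (mirrorRadicand d : ℤ) * (b:ℤ) ^ 2 = 4 * n := by
    rcases hunit.2.1 with h | h
    · exact ⟨1, Or.inl rfl, by rw [h]; norm_num⟩
    · exact ⟨-1, Or.inr rfl, by rw [h]; norm_num⟩
  -- the mirror discriminant `D = D⁺ > 0`: fundamental, `3d = D·s²` with `s ∈ {1, 3}`
  set D : ℤ := (if 3 ∣ d then ((d / 3 : ℕ) : ℤ) else 3 * (d : ℤ)) with hDdef
  have hDfund : (D % 4 = 1 ∧ Squarefree D ∧ D ≠ 1) ∨
      (4 ∣ D ∧ (D / 4 % 4 = 2 ∨ D / 4 % 4 = 3) ∧ Squarefree (D / 4)) := by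
    have h := isFundamental_mirrorDisc hd hd3
    rwa [← hDdef] at h
  have hDpos : 0 < D := by
    rw [hDdef]
    split_ifs with h
    · have : 0 < d / 3 := Nat.div_pos (Nat.le_of_dvd hd0 h) (by norm_num)
      exact_mod_cast this
    · omega
  obtain ⟨s, hs⟩ : ∃ s : ℚ, (3 : ℚ) * (d : ℚ) = (D : ℚ) * s ^ 2 := by
    by_cases h3d : 3 ∣ d
    · refine ⟨3, ?_⟩
      rw [hDdef, if_pos h3d]
      obtain ⟨e, rfl⟩ := h3d
      rw [Nat.mul_div_cancel_left e (by norm_num)]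
      push_cast
      ring
    · exact ⟨1, by rw [hDdef, if_neg h3d]; push_cast; ring⟩
  -- the imaginary quadratic field `K` of discriminant `-d`; `3 ∣ h_K` (Cox Thm 7.7)
  obtain ⟨K, _, _, h2, hdisc⟩ := Quadratic.exists_numberField_discr_eq hd
  have hneg : NumberField.discr K < 0 := by rw [hdisc]; omega
  have h3K : 3 ∣ NumberField.classNumber K := by
    rw [← Quadratic.card_reducedForms_eq_classNumber h2 hneg, hdisc]; exact hh
  -- an index-`3` subgroup of `Cl(𝓞 K)` (`#Cl[3] = 2·#{index-3 subgroups} + 1 > 1`)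
  obtain ⟨S, hS⟩ : ∃ S : Subgroup (ClassGroup (𝓞 K)), S.index = 3 := by
    have hlt := (three_dvd_classNumber_iff_one_lt_natCard K).mp h3K
    rw [← two_mul_card_subgroup_index_three_add_one] at hlt
    have hne : Nat.card {H : Subgroup (ClassGroup (𝓞 K)) // H.index = 3} ≠ 0 := by omega
    obtain ⟨⟨S, hS⟩⟩ := (Nat.card_ne_zero.mp hne).1
    exact ⟨S, hS⟩
  -- the cubic class field `E` of `S` (Artin reciprocity), unramified at all finite primes
  obtain ⟨E, hEfd, hEgal, hE3, hEunr, ψ, χ, -, hχ, hfrob⟩ := exists_isCubicClassField hS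
  haveI := hEfd
  haveI := hEgal
  -- `K/ℚ` is Galois
  haveI : Algebra.IsQuadraticExtension ℚ K := ⟨h2⟩
  haveI : IsGalois ℚ K := inferInstance
  -- `ζ = ζ₃ ∈ K̄`, `ζ ∉ K` (`d_K = -d ≠ -3`), and `g ∈ Aut(K̄/ℚ)` with `g|_K ≠ 1`, `g ζ = ζ²`
  obtain ⟨ζ, hζ⟩ : ∃ ζ : AlgebraicClosure K, IsPrimitiveRoot ζ 3 :=
    HasEnoughRootsOfUnity.exists_primitiveRoot (AlgebraicClosure K) 3
  have hD3 : NumberField.discr K ≠ -3 := by rw [hdisc]; omega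
  have hζK : ζ ∉ Set.range (algebraMap K (AlgebraicClosure K)) :=
    not_mem_range_algebraMap_of_isPrimitiveRoot h2 hD3 hζ
  obtain ⟨g, hgK, hgζ⟩ := exists_algEquiv_restrictNormal_ne_one hζ hζK h2
  -- `δ = √-d ∈ K`
  obtain ⟨δ, hδ, hδ2⟩ := Quadratic.exists_not_mem_range_sq_eq_discr h2
  rw [hdisc] at hδ2
  have hδ2' : δ ^ 2 = -(d : K) := by rw [hδ2, eq_ratCast]; push_cast; ring
  -- the REAL mirror field `k = ℚ(η)`, `η = δ(1 + 2ζ)`, `η² = 3d`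
  set η : AlgebraicClosure K := algebraMap K (AlgebraicClosure K) δ * (1 + 2 * ζ) with hηdef
  set k : IntermediateField ℚ (AlgebraicClosure K) := ℚ⟮η⟯ with hkdef
  have h2k : finrank ℚ k = 2 := finrank_adjoin_eta hζ hζK hδ hδ2
  haveI : FiniteDimensional ℚ k := Module.finite_of_finrank_eq_succ h2k
  haveI hknf : NumberField k := NumberField.of_module_finite ℚ _
  have hkM : ∀ x : AlgebraicClosure K, x ∈ k → x ∈ K⟮ζ⟯ := fun x hx =>
    mem_adjoin_of_mem_adjoin_eta hx
  have hMk : ∀ x ∈ K⟮ζ⟯, g x = x → x ∈ k := fun x hx hgx =>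
    mem_adjoin_eta_of_apply_eq h2 hζ hζK hgK hgζ hδ hδ2 hx hgx
  -- `E` is `g`-stable and `g` inverts `Gal(E/K)` (the class fields of a quadratic field are dihedral)
  have hgE : ∀ x ∈ E, g x ∈ E := fun x hx => apply_mem_of_frobData h2 hEunr hχ hfrob g hx
  have hinv : ∀ (h : AlgebraicClosure K ≃ₐ[K] AlgebraicClosure K), ∀ y ∈ E,
      g (h y) = h.symm (g y) :=
    fun h y hy => apply_apply_eq_symm_apply_of_frobData h2 hEunr hχ hfrob g hgK h hy
  -- Scholz's Kummer generator: `θ ∈ k`, `θ ≠ 0`, `θ = λ³` with `λ ∈ L = E·K(ζ)`, not a cube in `K(ζ)`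
  obtain ⟨θ, lam, hθ0, hlamL, hlam3, hθnc, -, -⟩ :=
    exists_kummer_generator h2 hζ hζK hgζ k hkM hMk E hE3 hEunr hgE hinv
  -- `d_k = D`, so `Cl(k)[3] = 1` and `d_k > 0`
  set ηk : k := ⟨η, IntermediateField.mem_adjoin_simple_self ℚ η⟩ with hηkdef
  have hηk : ηk ∉ Set.range (algebraMap ℚ k) := by
    rintro ⟨q, hq⟩
    apply eta_not_mem_range hζK hδ
    refine ⟨q, ?_⟩
    have h := congrArg (fun z : k => (z : AlgebraicClosure K)) hq
    rw [IsScalarTower.algebraMap_apply ℚ k (AlgebraicClosure K) q]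
    exact h
  have hηk2 : ηk ^ 2 = algebraMap ℚ k (-3 * ((-(d:ℤ) : ℤ) : ℚ)) := by
    apply Subtype.ext
    rw [SubmonoidClass.coe_pow]
    change η ^ 2 = ((algebraMap ℚ k (-3 * ((-(d:ℤ) : ℤ) : ℚ)) : k) : AlgebraicClosure K)
    rw [hηdef, eta_sq hζ hζK hδ2, eq_ratCast, eq_ratCast]
    push_cast
    rfl
  obtain ⟨q, -, hq⟩ := NumberField.exists_discr_eq_mul_sq h2k hηk hηk2
  have hdisck : NumberField.discr k = D :=
    Quadratic.eq_of_isFundamental_of_eq_mul_sq (Quadratic.isFundamentalDiscriminant_discr h2k) hDfund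
      (q := s * q) (by rw [hq]; push_cast; linear_combination q ^ 2 * hs)
  have hDk : 0 < NumberField.discr k := by rw [hdisck]; exact hDpos
  have hcl : ∀ c : ClassGroup (𝓞 k), c ^ 3 = 1 → c = 1 := by
    have hcard : Nat.card {c : ClassGroup (𝓞 k) // c ^ 3 = 1} = 1 := by
      rw [← quadFieldThreeTorsion_eq D k h2k hdisck]; exact ht
    intro c hc
    have hsub := (Nat.card_eq_one_iff_unique.mp hcard).1
    exact congrArg Subtype.val (hsub.elim ⟨c, hc⟩ ⟨1, one_pow 3⟩)
  -- the tower `k ⊆ M' = K(ζ') ⊆ L = E·K(ζ)` of number fields inside `K̄`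
  let L : IntermediateField K (AlgebraicClosure K) := E ⊔ K⟮ζ⟯
  haveI hLfd : FiniteDimensional K L := ScholzHecke.finiteDimensional_sup E ζ
  haveI hLgal : IsGalois K L := ScholzHecke.isGalois_sup E hζ
  haveI hLnf : NumberField L := NumberField.of_module_finite K L
  have hML_le : K⟮ζ⟯ ≤ L := le_sup_right
  let ζL : L := ⟨ζ, ScholzHecke.zeta_mem_sup E⟩
  let M' : IntermediateField K L := K⟮ζL⟯
  haveI hM'nf : NumberField M' := NumberField.of_module_finite K M'
  have hKM' : finrank K M' = 2 := ScholzHecke.finrank_adjoin_zeta_internal E hζ hζK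
  have hmemM' : ∀ x : L, x ∈ M' ↔ (x : AlgebraicClosure K) ∈ K⟮ζ⟯ := fun x => by
    rw [← IntermediateField.mem_lift x, IntermediateField.lift_adjoin_simple]
  have hkL : ∀ x : AlgebraicClosure K, x ∈ k → x ∈ L := fun x hx => hML_le (hkM x hx)
  let fkM : k →+* M' :=
    { toFun := fun x => ⟨⟨x.1, hkL x.1 x.2⟩, (hmemM' _).mpr (hkM x.1 x.2)⟩
      map_one' := rfl
      map_mul' := fun _ _ => rfl
      map_zero' := rfl
      map_add' := fun _ _ => rfl }
  letI : Algebra k M' := fkM.toAlgebra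
  letI : Algebra k L := ((algebraMap M' L).comp fkM).toAlgebra
  haveI : IsScalarTower k M' L := IsScalarTower.of_algebraMap_eq fun _ => rfl
  haveI : IsScalarTower k L (AlgebraicClosure K) := IsScalarTower.of_algebraMap_eq fun _ => rfl
  -- `[M' : k] ≤ 2`: every `x ∈ K(ζ)` is `u + w ζ` with `w = (x - g x)/(1 + 2ζ)`, `u = x - w ζ` in `K(ζ)^g ⊆ k`
  have hζ2 : ζ ^ 2 = -ζ - 1 := zeta_sq_eq hζ hζK
  have h12ζ : (1 + 2 * ζ : AlgebraicClosure K) ≠ 0 := by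
    intro h0
    have h1 : (1 + 2 * ζ : AlgebraicClosure K) ^ 2 = -3 := one_add_two_mul_zeta_sq hζ hζK
    rw [h0] at h1
    norm_num at h1
  have h2M : (2 : AlgebraicClosure K) ∈ K⟮ζ⟯ := by exact_mod_cast K⟮ζ⟯.natCast_mem 2
  have hζM : ζ ∈ K⟮ζ⟯ := IntermediateField.mem_adjoin_simple_self K ζ
  let ζM : M' := ⟨ζL, IntermediateField.mem_adjoin_simple_self K ζL⟩
  have hspan : ∀ x : M', ∃ u w : k, x = u • (1 : M') + w • ζM := by
    intro x
    have hxM : ((x : L) : AlgebraicClosure K) ∈ K⟮ζ⟯ := (hmemM' _).mp x.2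
    set xΩ : AlgebraicClosure K := ((x : L) : AlgebraicClosure K) with hxΩ
    set wΩ : AlgebraicClosure K := (xΩ - g xΩ) / (1 + 2 * ζ) with hwΩ
    set uΩ : AlgebraicClosure K := xΩ - wΩ * ζ with huΩ
    have hgx : g (g xΩ) = xΩ := apply_apply_eq_self_of_mem_adjoin hζ h2 g hgζ hxM
    have hgxM : g xΩ ∈ K⟮ζ⟯ := apply_mem_adjoin_of hζ g hxM
    have hwM : wΩ ∈ K⟮ζ⟯ :=
      div_mem (sub_mem hxM hgxM) (add_mem (one_mem _) (mul_mem h2M hζM))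
    have hgw : g wΩ = wΩ := by
      have hden : (1 + 2 * ζ ^ 2 : AlgebraicClosure K) = -(1 + 2 * ζ) := by rw [hζ2]; ring
      rw [hwΩ, map_div₀, map_sub, map_add, map_one, map_mul, map_ofNat, hgx, hgζ, hden,
        show g xΩ - xΩ = -(xΩ - g xΩ) by ring, neg_div_neg_eq]
    have huM : uΩ ∈ K⟮ζ⟯ := sub_mem hxM (mul_mem hwM hζM)
    have hgu : g uΩ = uΩ := by
      have hw' : wΩ * (1 + 2 * ζ) = xΩ - g xΩ := div_mul_cancel₀ _ h12ζ
      rw [huΩ, map_sub, map_mul, hgw, hgζ, hζ2]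
      linear_combination hw'
    refine ⟨⟨uΩ, hMk _ huM hgu⟩, ⟨wΩ, hMk _ hwM hgw⟩, ?_⟩
    apply Subtype.ext
    apply Subtype.ext
    change xΩ = uΩ * 1 + wΩ * ζ
    rw [huΩ]
    ring
  have hkM' : finrank k M' ≤ 2 := finrank_le_two_of_forall_exists (1 : M') ζM hspan
  -- `L/M'` is unramified at every prime (base change of the unramified `E/K`)
  have hunrL : ∀ (P : Ideal (𝓞 L)) [P.IsMaximal], P ≠ ⊥ → P.ramificationIdx (𝓞 M') = 1 := by
    intro P _ _
    haveI := ScholzHecke.isUnramifiedAt_sup E hζ hζK hE3 hEunr P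
    exact Ideal.ramificationIdx_eq_one_of_isUnramifiedAt
  -- the unit `ε = (a + b√d₀)/2` of `𝓞_k` (`√d₀ = η/c₀`), not the cube of a unit
  have hc₀k : (c₀ : k) ≠ 0 := Nat.cast_ne_zero.mpr hc₀0
  set sk : k := ηk / c₀ with hskdef
  have hηk2' : ηk ^ 2 = 3 * (d : k) := by
    rw [hηk2, eq_ratCast]; push_cast; ring
  have hsk2 : sk ^ 2 = (mirrorRadicand d : k) := by
    have h3d : (3 * d : k) = mirrorRadicand d * (c₀ : k) ^ 2 := by exact_mod_cast hc₀
    rw [hskdef, div_pow, hηk2', div_eq_iff (pow_ne_zero 2 hc₀k)]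
    linear_combination h3d
  have hsk : sk ∉ Set.range (algebraMap ℚ k) := by
    rintro ⟨r, hr⟩
    apply hηk
    refine ⟨r * c₀, ?_⟩
    rw [map_mul, map_natCast, hr, hskdef, div_mul_cancel₀ _ hc₀k]
  obtain ⟨ηε, hηε⟩ := exists_unit_coe_eq_half (k := k) hsk2 hn hab
  have hηεnc : ηε ∉ Quadratic.unitCubes k :=
    not_mem_unitCubes_of_isMirrorFundUnit h2k hsk hd hd3 hsk2 hunit hηε
  -- `θ = λ³` in `L`, and `θ` is not a cube in `M'`
  set w : L := ⟨lam, hlamL⟩ with hwdef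
  have hw : w ^ 3 = algebraMap k L θ := by
    apply Subtype.ext
    rw [SubmonoidClass.coe_pow]
    exact hlam3
  have hθM' : ∀ e : M', e ^ 3 ≠ algebraMap k M' θ := by
    intro e he
    apply hθnc ((e : L) : AlgebraicClosure K) ((hmemM' _).mp e.2)
    have h := congrArg (fun m : M' => ((m : L) : AlgebraicClosure K)) he
    simp only [SubmonoidClass.coe_pow] at h
    exact h
  -- hence `ε` has a cube root `y₀` in `L` (`θ = εʲ z³`, `j ≠ 0`, as `Cl(k)[3] = 1`)
  obtain ⟨y₀, hy₀⟩ := ScholzHecke.exists_cube_root_unit (k := k) (M := M') (L := L) h2k hDk hcl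
    hkM' hunrL hηεnc hw hθM'
  -- `λ_M = 1 + 2ζ'` (`λ_M² = -3`) and `ε = a/2 + (b/2c₀)·δλ_M` in `M'`
  set lamM : M' := 1 + 2 * ζM with hlamMdef
  have hlamMΩ : algebraMap M' (AlgebraicClosure K) lamM = 1 + 2 * ζ := by
    rw [hlamMdef, map_add, map_one, map_mul, map_ofNat]
    rfl
  have hlamM : lamM ^ 2 = -3 := by
    apply (algebraMap M' (AlgebraicClosure K)).injective
    rw [map_pow, hlamMΩ, map_neg, map_ofNat]
    exact one_add_two_mul_zeta_sq hζ hζK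
  have hy : y₀ ^ 3 =
      algebraMap M' L ((a : M') / 2 + (b : M') / (2 * c₀) * algebraMap K M' δ * lamM) := by
    rw [hy₀, hηε]
    apply (algebraMap L (AlgebraicClosure K)).injective
    rw [← IsScalarTower.algebraMap_apply k L (AlgebraicClosure K),
      ← IsScalarTower.algebraMap_apply M' L (AlgebraicClosure K)]
    simp only [map_add, map_mul, map_div₀, map_natCast, map_ofNat, hlamMΩ,
      ← IsScalarTower.algebraMap_apply K M' (AlgebraicClosure K)]
    have hskΩ : algebraMap k (AlgebraicClosure K) sk = η / c₀ := by
      rw [hskdef, map_div₀, map_natCast]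
      rfl
    have hc₀Ω : (c₀ : AlgebraicClosure K) ≠ 0 := Nat.cast_ne_zero.mpr hc₀0
    rw [hskΩ, hηdef]
    field_simp
  -- Hecke's theorem 119 at the primes above `3` of `M'`: `UnitCubeAtThree d`
  exact ScholzHecke.unitCubeAtThree_of_isUnramifiedAt h2 hδ hδ2' hd hd3 hunit hc₀0 hc₀ (M := M')
    hKM' hlamM (N := L) hy fun 𝔔 _ => ScholzHecke.isUnramifiedAt_sup E hζ hζK hE3 hEunr 𝔔

end Summit.QuantumAdvantage.QuantumAdvantage.Theorems.AvgFaceBeyondPrior.Mirror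

end
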